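import Literature.MathematicalPhysics.QuantumFieldTheory.Balaban1983to89.B1Eq110GaugeFixing

/-!
# `Balaban1983to89.B1Eq110GaugeInvariantObservables` — T. Bałaban, *(Higgs)₂,₃ quantum fields in a finite volume. I. A lower bound*,
Commun. Math. Phys. **85** (1982) 603–626 [Balaban1982Higgs1], p. 605, (1.9)–(1.11): **the un-normalised and the NORMALISED
expectations of every integrable gauge-invariant REAL observable agree between the model (1.8)/(1.9) and its Feynman-gauge version
(1.10)/(1.11)** — p. 605 *"The same gauge fixing procedure can be applied also to gauge-invariant Schwinger functions"* — PROVED for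
the massive abelian lattice Higgs model on the CONCRETE carrier `…Balaban1983to89.HiggsLattice`

statement-level skeleton of published theorems with citation tags; proofs where landed; nothing here is a claim about the Yang–Mills mass gap

PDF held: `paper:balaban1982-cmp85-higgs23-i` (journal page = PDF page + 602), p. 605 [PDF 3].

WHAT IS REPRODUCED.  SKELETON row **B1.Eq1.9-1.10** (owners r01/r14), DEPGRAPH node `EXT:BFS1979` at its B1 use; sixth (supplementary)
file of the lit-balaban seat-p28 (gen 8) series `…HiggsHodgeIdentity` → `…HiggsGaugeInvariance` → `…B1Eq110GaugeOrbit` →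
`…B1Eq110OrbitGaussians` → `…B1Eq110GaugeFixing` (the identity `c·∫F e^{−S'} = c′·e^{E}·∫F e^{−S}` for measurable gauge-invariant
`F ≥ 0` with values in `[0,∞]`, and `Z'^ε = κ·e^{E}·Z^ε`, `κ = c′/c`).  p. 605, verbatim: *"In Sect. 5.1 the authors [of [5] =
Brydges–Fröhlich–Seiler, Ann. Phys. 121 (1979), NOT HELD (acq-09341) — nothing is quoted from it] have shown how to introduce the gauge
fixing terms in the integral (1.9), using the properties of (1.8) under the gauge transformations. The same gauge fixing procedure can
be applied also to gauge-invariant Schwinger functions. We introduce here the Feynman gauge and we will consider the integral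
Z^ε = ∫dA∫dφ exp(−S^ε(A,φ)) (1.10) instead of (1.9)"*.  Here, for REAL-valued observables `F(A,φ)` invariant under
`(A,φ) ↦ (A − ∂^ελ, U(λ)φ)`, with `μ₀² > 0`:
* `integrable_mul_exp_neg_actionPrime` — if `F e^{−S^ε}` is integrable then so is `F e^{−S'^ε}`;
* `integral_gaugeFixing` — **`∫dAdφ F e^{−S'^ε} = κ · e^{E} · ∫dAdφ F e^{−S^ε}`** (`κ = B1Eq110GaugeFixing.gaugeOrbitFactor`);
* `schwingerFn_eq` — **`(∫F e^{−S'^ε}) / Z'^ε = (∫F e^{−S^ε}) / Z^ε`**: the gauge-invariant Schwinger functions of (1.9) are those of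
  the gauge-fixed integral (1.10) (also `λ > 0`, so that `Z^ε, Z'^ε ∈ (0,∞)`), which is the sense of *"we will consider the integral
  (1.10) instead of (1.9)"*.
Mechanism: positive and negative parts of `F` are again measurable and gauge invariant; apply `B1Eq110GaugeFixing.gaugeFixing_lintegral`
to each and pass to real integrals.  Nothing of [Balaban1982Higgs1] beyond the quoted sentences is asserted; no `Prop`-valued fact is
introduced.  Unit `lit-balaban-p28` (Phase-2 proof seat p28, gen 8), HOME `run/shared/lean/pub/lit-balaban/`.
-/

open scoped BigOperators ENNReal
open _root_.MeasureTheory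

namespace Literature.MathematicalPhysics.QuantumFieldTheory.Balaban1983to89.B1Eq110GaugeInvariantObservables

open HiggsLattice HiggsCovariancePos HiggsHodgeIdentity HiggsGaugeInvariance B1Eq110GaugeOrbit B1Eq110OrbitGaussians
  B1Eq110GaugeFixing

variable {P : Params} {k N : ℕ}

noncomputable section

/-- from `c·x = c′·e^{E}·y` in `[0,∞]` with `y < ∞` (and `μ₀² > 0`): `x < ∞` and `x = κ·e^{E}·y` as real numbers. [folklore] -/
private theorem toReal_of_identity {mu0sq E : ℝ} (hmu : 0 < mu0sq) {x y : ℝ≥0∞} (hy : y ≠ ∞)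
    (h : cFull P k mu0sq * x = cPrime P k mu0sq * ENNReal.ofReal (Real.exp E) * y) :
    x ≠ ∞ ∧ x.toReal = gaugeOrbitFactor P k mu0sq * Real.exp E * y.toReal := by
  have hR : cPrime P k mu0sq * ENNReal.ofReal (Real.exp E) * y ≠ ∞ :=
    ENNReal.mul_ne_top (ENNReal.mul_ne_top (cPrime_lt_top hmu).ne ENNReal.ofReal_ne_top) hy
  have hx : x ≠ ∞ := by
    intro htop
    apply hR
    rw [← h, htop, ENNReal.mul_top (cFull_pos mu0sq).ne']
  refine ⟨hx, ?_⟩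
  have h' := congrArg ENNReal.toReal h
  rw [ENNReal.toReal_mul, ENNReal.toReal_mul, ENNReal.toReal_mul, ENNReal.toReal_ofReal (Real.exp_pos _).le] at h'
  have hc : 0 < (cFull P k mu0sq).toReal := ENNReal.toReal_pos (cFull_pos mu0sq).ne' (cFull_lt_top hmu).ne
  unfold gaugeOrbitFactor
  field_simp
  linarith

/-- the nonnegative case: for measurable gauge-invariant `G ≥ 0` with `G e^{−S}` integrable, `G e^{−S'}` is integrable and
`∫G e^{−S'} = κ e^{E} ∫G e^{−S}`. [folklore] -/
private theorem nonneg_case (C : ChargeData N) (c : Couplings) (hmu : 0 < c.mu0sq)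
    {G : VecField P k × ScalarField P k N → ℝ} (hG : Measurable G) (h0 : ∀ Φ, 0 ≤ G Φ)
    (hinv : ∀ (lam : Site P k → ℝ) (Φ : VecField P k × ScalarField P k N), G (gaugeMap C lam Φ) = G Φ)
    (hint : Integrable fun Φ : VecField P k × ScalarField P k N => G Φ * Real.exp (-action C c Φ.1 Φ.2)) :
    Integrable (fun Φ : VecField P k × ScalarField P k N => G Φ * Real.exp (-actionPrime C c Φ.1 Φ.2)) ∧
    ∫ Φ : VecField P k × ScalarField P k N, G Φ * Real.exp (-actionPrime C c Φ.1 Φ.2)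
      = gaugeOrbitFactor P k c.mu0sq * Real.exp c.E *
        ∫ Φ : VecField P k × ScalarField P k N, G Φ * Real.exp (-action C c Φ.1 Φ.2) := by
  have hGm : Measurable fun Φ : VecField P k × ScalarField P k N => ENNReal.ofReal (G Φ) :=
    ENNReal.measurable_ofReal.comp hG
  have hGinv : ∀ (lam : Site P k → ℝ) (Φ : VecField P k × ScalarField P k N),
      ENNReal.ofReal (G (gaugeMap C lam Φ)) = ENNReal.ofReal (G Φ) := fun lam Φ => by rw [hinv]
  have h := gaugeFixing_lintegral (P := P) (k := k) C c hGm hGinv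
  simp_rw [← ENNReal.ofReal_mul (h0 _)] at h
  have h0P : 0 ≤ᵐ[volume] fun Φ : VecField P k × ScalarField P k N => G Φ * Real.exp (-actionPrime C c Φ.1 Φ.2) :=
    Filter.Eventually.of_forall fun Φ => mul_nonneg (h0 Φ) (Real.exp_pos _).le
  have h0F : 0 ≤ᵐ[volume] fun Φ : VecField P k × ScalarField P k N => G Φ * Real.exp (-action C c Φ.1 Φ.2) :=
    Filter.Eventually.of_forall fun Φ => mul_nonneg (h0 Φ) (Real.exp_pos _).le
  have hy : ∫⁻ Φ : VecField P k × ScalarField P k N, ENNReal.ofReal (G Φ * Real.exp (-action C c Φ.1 Φ.2)) ≠ ∞ :=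
    (hint.lintegral_lt_top).ne
  obtain ⟨hx, hxeq⟩ := toReal_of_identity (P := P) (k := k) hmu hy h
  have hmeas : AEStronglyMeasurable
      (fun Φ : VecField P k × ScalarField P k N => G Φ * Real.exp (-actionPrime C c Φ.1 Φ.2)) volume :=
    (hG.mul (Real.continuous_exp.comp (continuous_actionPrime C c).neg).measurable).aestronglyMeasurable
  have hint' : Integrable fun Φ : VecField P k × ScalarField P k N => G Φ * Real.exp (-actionPrime C c Φ.1 Φ.2) := by
    refine ⟨hmeas, ?_⟩
    rw [hasFiniteIntegral_iff_ofReal h0P]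
    exact lt_top_iff_ne_top.2 hx
  refine ⟨hint', ?_⟩
  rw [integral_eq_lintegral_of_nonneg_ae h0P hmeas, integral_eq_lintegral_of_nonneg_ae h0F hint.aestronglyMeasurable]
  exact hxeq

/-- **integrability transfers from (1.10) to (1.9)**: for a measurable gauge-invariant real observable `F` with `F e^{−S^ε}` integrable
(`μ₀² > 0`), `F e^{−S'^ε}` is integrable. [cite: Balaban1982Higgs1, (1.9)–(1.10) p.605] -/
theorem integrable_mul_exp_neg_actionPrime (C : ChargeData N) (c : Couplings) (hmu : 0 < c.mu0sq)
    {F : VecField P k × ScalarField P k N → ℝ} (hF : Measurable F)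
    (hinv : ∀ (lam : Site P k → ℝ) (Φ : VecField P k × ScalarField P k N), F (gaugeMap C lam Φ) = F Φ)
    (hint : Integrable fun Φ : VecField P k × ScalarField P k N => F Φ * Real.exp (-action C c Φ.1 Φ.2)) :
    Integrable fun Φ : VecField P k × ScalarField P k N => F Φ * Real.exp (-actionPrime C c Φ.1 Φ.2) := by
  have habs : Integrable fun Φ : VecField P k × ScalarField P k N => |F Φ| * Real.exp (-action C c Φ.1 Φ.2) := by
    refine (hint.abs).congr (Filter.Eventually.of_forall fun Φ => ?_)
    simp only [abs_mul, abs_of_pos (Real.exp_pos _)]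
  have h := (nonneg_case C c hmu (G := fun Φ => |F Φ|) hF.abs (fun Φ => abs_nonneg _)
    (fun lam Φ => by simp only [hinv]) habs).1
  refine h.mono' ((hF.mul (Real.continuous_exp.comp (continuous_actionPrime C c).neg).measurable).aestronglyMeasurable)
    (Filter.Eventually.of_forall fun Φ => ?_)
  rw [Real.norm_eq_abs, abs_mul, abs_of_pos (Real.exp_pos _)]

/-- **`∫dAdφ F e^{−S'^ε} = κ · e^{E} · ∫dAdφ F e^{−S^ε}` for every measurable gauge-invariant REAL observable `F` with `F e^{−S^ε}`
integrable** (`μ₀² > 0`; `κ = c′/c` the gauge-orbit volume factor of `…B1Eq110GaugeFixing`) — p. 605 *"The same gauge fixing procedure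
can be applied also to gauge-invariant Schwinger functions"*. [cite: Balaban1982Higgs1, (1.9)–(1.10) p.605] -/
theorem integral_gaugeFixing (C : ChargeData N) (c : Couplings) (hmu : 0 < c.mu0sq)
    {F : VecField P k × ScalarField P k N → ℝ} (hF : Measurable F)
    (hinv : ∀ (lam : Site P k → ℝ) (Φ : VecField P k × ScalarField P k N), F (gaugeMap C lam Φ) = F Φ)
    (hint : Integrable fun Φ : VecField P k × ScalarField P k N => F Φ * Real.exp (-action C c Φ.1 Φ.2)) :
    ∫ Φ : VecField P k × ScalarField P k N, F Φ * Real.exp (-actionPrime C c Φ.1 Φ.2)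
      = gaugeOrbitFactor P k c.mu0sq * Real.exp c.E *
        ∫ Φ : VecField P k × ScalarField P k N, F Φ * Real.exp (-action C c Φ.1 Φ.2) := by
  -- positive and negative parts
  set Fp : VecField P k × ScalarField P k N → ℝ := fun Φ => max (F Φ) 0 with hFp
  set Fm : VecField P k × ScalarField P k N → ℝ := fun Φ => max (-F Φ) 0 with hFm
  have hFpm : Measurable Fp := hF.max measurable_const
  have hFmm : Measurable Fm := hF.neg.max measurable_const
  have hsplit : ∀ Φ, F Φ = Fp Φ - Fm Φ := fun Φ => by
    simp only [hFp, hFm]; rcases le_total 0 (F Φ) with h | h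
    · rw [max_eq_left h, max_eq_right (neg_nonpos.2 h), sub_zero]
    · rw [max_eq_right h, max_eq_left (neg_nonneg.2 h)]; ring
  have hle_p : ∀ Φ, |Fp Φ| ≤ |F Φ| := fun Φ => by
    simp only [hFp]; rcases le_total 0 (F Φ) with h | h
    · rw [max_eq_left h]
    · rw [max_eq_right h, abs_zero]; exact abs_nonneg _
  have hle_m : ∀ Φ, |Fm Φ| ≤ |F Φ| := fun Φ => by
    simp only [hFm]; rcases le_total 0 (F Φ) with h | h
    · rw [max_eq_right (neg_nonpos.2 h), abs_zero]; exact abs_nonneg _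
    · rw [max_eq_left (neg_nonneg.2 h), abs_neg]
  have hw : Continuous fun Φ : VecField P k × ScalarField P k N => Real.exp (-action C c Φ.1 Φ.2) :=
    Real.continuous_exp.comp (HiggsActionIntegrable.continuous_action C c).neg
  have hdom : ∀ {G : VecField P k × ScalarField P k N → ℝ}, Measurable G → (∀ Φ, |G Φ| ≤ |F Φ|) →
      Integrable fun Φ : VecField P k × ScalarField P k N => G Φ * Real.exp (-action C c Φ.1 Φ.2) := by
    intro G hG hle
    refine hint.mono ((hG.mul hw.measurable).aestronglyMeasurable) (Filter.Eventually.of_forall fun Φ => ?_)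
    rw [Real.norm_eq_abs, abs_mul, abs_of_pos (Real.exp_pos _), Real.norm_eq_abs, abs_mul, abs_of_pos (Real.exp_pos _)]
    exact mul_le_mul_of_nonneg_right (hle Φ) (Real.exp_pos _).le
  have hinv_p : ∀ (lam : Site P k → ℝ) (Φ : VecField P k × ScalarField P k N), Fp (gaugeMap C lam Φ) = Fp Φ :=
    fun lam Φ => by simp only [hFp, hinv]
  have hinv_m : ∀ (lam : Site P k → ℝ) (Φ : VecField P k × ScalarField P k N), Fm (gaugeMap C lam Φ) = Fm Φ :=
    fun lam Φ => by simp only [hFm, hinv]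
  obtain ⟨hIp, hEp⟩ := nonneg_case C c hmu hFpm (fun Φ => le_max_right _ _) hinv_p (hdom hFpm hle_p)
  obtain ⟨hIm, hEm⟩ := nonneg_case C c hmu hFmm (fun Φ => le_max_right _ _) hinv_m (hdom hFmm hle_m)
  have eP : (fun Φ : VecField P k × ScalarField P k N => F Φ * Real.exp (-actionPrime C c Φ.1 Φ.2))
      = fun Φ => Fp Φ * Real.exp (-actionPrime C c Φ.1 Φ.2) - Fm Φ * Real.exp (-actionPrime C c Φ.1 Φ.2) := by
    funext Φ; rw [hsplit Φ]; ring
  have eF : (fun Φ : VecField P k × ScalarField P k N => F Φ * Real.exp (-action C c Φ.1 Φ.2))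
      = fun Φ => Fp Φ * Real.exp (-action C c Φ.1 Φ.2) - Fm Φ * Real.exp (-action C c Φ.1 Φ.2) := by
    funext Φ; rw [hsplit Φ]; ring
  rw [eP, eF, integral_sub hIp hIm, integral_sub (hdom hFpm hle_p) (hdom hFmm hle_m), hEp, hEm]
  ring

/-- **THE GAUGE-INVARIANT SCHWINGER FUNCTIONS OF (1.9) ARE THOSE OF THE GAUGE-FIXED INTEGRAL (1.10)**:
`(∫dAdφ F e^{−S'^ε}) / Z'^ε = (∫dAdφ F e^{−S^ε}) / Z^ε` for every measurable gauge-invariant real observable `F` with `F e^{−S^ε}`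
integrable, under the standing assumptions `μ₀² > 0`, `λ > 0` of p. 605 — *"The same gauge fixing procedure can be applied also to
gauge-invariant Schwinger functions. We introduce here the Feynman gauge and we will consider the integral (1.10) instead of (1.9)"*.
[cite: Balaban1982Higgs1, (1.9)–(1.10) p.605] -/
theorem schwingerFn_eq (C : ChargeData N) (c : Couplings) (hmu : 0 < c.mu0sq) (hlam : 0 < c.lam)
    {F : VecField P k × ScalarField P k N → ℝ} (hF : Measurable F)
    (hinv : ∀ (lam : Site P k → ℝ) (Φ : VecField P k × ScalarField P k N), F (gaugeMap C lam Φ) = F Φ)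
    (hint : Integrable fun Φ : VecField P k × ScalarField P k N => F Φ * Real.exp (-action C c Φ.1 Φ.2)) :
    (∫ Φ : VecField P k × ScalarField P k N, F Φ * Real.exp (-actionPrime C c Φ.1 Φ.2)) / partitionFnPrime P k N C c
      = (∫ Φ : VecField P k × ScalarField P k N, F Φ * Real.exp (-action C c Φ.1 Φ.2)) / partitionFn P k N C c := by
  rw [integral_gaugeFixing C c hmu hF hinv hint, partitionFnPrime_eq C c hmu hlam]
  rw [mul_assoc, mul_assoc, mul_div_mul_left _ _ (gaugeOrbitFactor_pos hmu).ne', mul_div_mul_left _ _ (Real.exp_pos _).ne']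

/-- in particular the normalised expectations `⟨F⟩' = Z'⁻¹∫F e^{−S'}` and `⟨F⟩ = Z⁻¹∫F e^{−S}` coincide (same statement with the
normalisation written as a prefactor). [cite: Balaban1982Higgs1, (1.9)–(1.10) p.605] -/
theorem expectation_eq (C : ChargeData N) (c : Couplings) (hmu : 0 < c.mu0sq) (hlam : 0 < c.lam)
    {F : VecField P k × ScalarField P k N → ℝ} (hF : Measurable F)
    (hinv : ∀ (lam : Site P k → ℝ) (Φ : VecField P k × ScalarField P k N), F (gaugeMap C lam Φ) = F Φ)
    (hint : Integrable fun Φ : VecField P k × ScalarField P k N => F Φ * Real.exp (-action C c Φ.1 Φ.2)) :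
    (partitionFnPrime P k N C c)⁻¹ * ∫ Φ : VecField P k × ScalarField P k N, F Φ * Real.exp (-actionPrime C c Φ.1 Φ.2)
      = (partitionFn P k N C c)⁻¹ * ∫ Φ : VecField P k × ScalarField P k N, F Φ * Real.exp (-action C c Φ.1 Φ.2) := by
  rw [inv_mul_eq_div, inv_mul_eq_div]
  exact schwingerFn_eq C c hmu hlam hF hinv hint

end

end Literature.MathematicalPhysics.QuantumFieldTheory.Balaban1983to89.B1Eq110GaugeInvariantObservables
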